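import Mathlib
import HarnessLib
import Summits.HubbardSuperconductivity.HubbardSuperconductivity.Theorems.KLProgrammeKLRegimeEngineRelGainWindowed
import Summits.HubbardSuperconductivity.HubbardSuperconductivity.Theorems.KLProgrammeKLRegimeEngineValueClauseReduction

/-!
# Route `KLProgramme` — ENGINE child gen 8 (stmt-HubbardSuperconductivity-20437 `KLRegimeEngineV17F2`), skeleton v2 class #5 rev 3, (X).3 BUDGET ARITHMETIC (block B):
# the DRESSING KIT for the explicit analytic majorant — `klbd_const_dressing`, `klbd_min_le_klRelGain`, `klbd_minProfile_conv_le` (+ `_left`, `_crossed`), and their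
# instances on the dressing rung profiles `ρ_j′ = klRungProfile … n s_{n+1,j′}` (cell gate-hubbard-kl, seat hubbard-kl-k3c1-p1 g15; row 77 of CLASS5-RESOLVED-STEP.md / KLTC-INDEX v12)

WHY.  The ONE budget row of the (X).3 producer (candidate «76», `exists_isTransferPkg7_of_analytic_resolved_convGrid_klTS`) reads, per pair and `k k′` in the ball,
`Ran(k,k′) + Σ_c Ran(k,c)·ρ_{j′}(c)·(3m/2) + Σ_a (3m/2)·ρ_j(a)·Ran(a,k′) + Σ_a Σ_c (3m/2)ρ_j(a)·Ran(a,c)·ρ_{j′}(c)(3m/2) ≤ θ·(2^{−(n+2)}·bar + (3/5)·ROOM)`, and after rows 66–75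
`Ran`'s explicit lower bound is a sum of (i) terms CONSTANT in `(x,y)` (the convolved PH masses, the ≥2-cross mass, the flat edges, …), (ii) PROFILE terms
`c·min(|x−y|_𝕋/Λₙ₊₁, Λₙ₊₁/|x−y|_𝕋)` and the crossed `c·min(|x+y−Qm|_𝕋/Λₙ₊₁, Λₙ₊₁/|x+y−Qm|_𝕋)` (the D-lines and the `(x,y)` PH profiles above threshold), (iii) the residual function
rows.  This file is the generic arithmetic that carries (i) and (ii) through the three dressing sums:
* `klbd_const_dressing` — a constant `C ≥ 0` dressed by weights of total masses `Z, Z′`: `≤ C·(1 + (3m/2)Z)·(1 + (3m/2)Z′)`;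
* `klbd_min_le_klRelGain` — `min(ρ/Λₙ, Λₙ/ρ) ≤ klRelGain n ρ` (the shell count only enlarges), whence `klbd_minProfile_conv_le` — the `min` profile convolved against a
  WINDOWED weight (`Σ_{|c−x|≤η} w ≤ A·η` for `η ≥ η₀`, `η₀ ≤ Λₙ`, `Σ w ≤ Z`) is `≤ (n+2)·(A·Λₙ·(1+2I) + Z/2^I)` for every shell number `I` (k3c1-p1 g11's layer cake
  `klam_sum_relGain_mul_le`); `_left` (profile read at `|x − c|`) and `_crossed` (at `|x + c − Qm|`, window centre `Qm − x`);
* instances on the rung profile of the dressing (`sum_window_klRungProfile_compl_le_linear`: `A = 2·369144/π`, `η₀ = π/L`; `sum_klRungProfile_compl_le`: `Z = 738288`):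
  `klbd_minProfile_conv_rungProfile_le(_crossed)`, `klbd_rungProfile_total` (the numbers B1–B2 of the memo CLASS5-RESOLVED-STEP.md §9).
Pure real arithmetic over landed rows; nothing about the model's sizes is asserted; nothing asserts (X).3, (c), K3 or superconductivity.  0 kit · 0 lit.
-/

noncomputable section

namespace Summit.HubbardSuperconductivity.HubbardSuperconductivity.Theorems.KLRegimeSplit

set_option linter.dupNamespace false -- summit = problem name (single-conjunct summit), D-0017

open Finset Literature.MathematicalPhysics.QuantumLattice Literature.Probability.LatticeModels
open Summit.HubbardSuperconductivity.HubbardSuperconductivity.Theorems.KLProgrammeLegKernels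
open Summit.HubbardSuperconductivity.HubbardSuperconductivity.Theorems.DispersionFlow

/-! ## §1 Constants through the dressing -/

section Const

/-- **A constant through the three dressing sums**: for `C ≥ 0`, `m ≥ 0` and weights `ρ, ρ′ ≥ 0` of total masses `≤ Z, Z′`,
`C + Σ_c C·ρ′(c)·(3m/2) + Σ_a (3m/2)·ρ(a)·C + Σ_a Σ_c (3m/2)·ρ(a)·C·ρ′(c)·(3m/2) ≤ C·(1 + (3m/2)·Z)·(1 + (3m/2)·Z′)`. -/
theorem klbd_const_dressing {ι : Type*} [Fintype ι] (ρ ρ' : ι → ℝ) {C m Z Z' : ℝ} (hC : 0 ≤ C) (hm : 0 ≤ m)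
    (hρ : ∀ a, 0 ≤ ρ a) (hρ' : ∀ c, 0 ≤ ρ' c) (hZ : ∑ a, ρ a ≤ Z) (hZ' : ∑ c, ρ' c ≤ Z') :
    C + ∑ c, C * ρ' c * (3 / 2 * m) + ∑ a, 3 / 2 * m * ρ a * C + ∑ a, ∑ c, 3 / 2 * m * ρ a * C * ρ' c * (3 / 2 * m) ≤
      C * (1 + 3 / 2 * m * Z) * (1 + 3 / 2 * m * Z') := by
  have e1 : ∑ c, C * ρ' c * (3 / 2 * m) = C * (3 / 2 * m) * ∑ c, ρ' c := by
    rw [Finset.mul_sum]; exact Finset.sum_congr rfl fun c _ => by ring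
  have e2 : ∑ a, 3 / 2 * m * ρ a * C = C * (3 / 2 * m) * ∑ a, ρ a := by
    rw [Finset.mul_sum]; exact Finset.sum_congr rfl fun a _ => by ring
  have e3 : ∑ a, ∑ c, 3 / 2 * m * ρ a * C * ρ' c * (3 / 2 * m) = C * (3 / 2 * m) * (3 / 2 * m) * ((∑ a, ρ a) * ∑ c, ρ' c) := by
    rw [Finset.sum_mul, Finset.mul_sum]
    refine Finset.sum_congr rfl fun a _ => ?_
    rw [Finset.mul_sum, Finset.mul_sum]
    exact Finset.sum_congr rfl fun c _ => by ring
  rw [e1, e2, e3]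
  have hS : 0 ≤ ∑ a, ρ a := Finset.sum_nonneg fun a _ => hρ a
  have hS' : 0 ≤ ∑ c, ρ' c := Finset.sum_nonneg fun c _ => hρ' c
  have hCm : 0 ≤ C * (3 / 2 * m) := by positivity
  have h1 := mul_le_mul_of_nonneg_left hZ' hCm
  have h2 := mul_le_mul_of_nonneg_left hZ hCm
  have h3 := mul_le_mul_of_nonneg_left (mul_le_mul hZ hZ' hS' (hS.trans hZ)) (mul_nonneg hCm (by positivity : (0 : ℝ) ≤ 3 / 2 * m))
  nlinarith

end Const

/-! ## §2 The `min` profile through a windowed weight -/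

section Profile

variable {L : ℕ} [NeZero L]

omit [NeZero L] in
/-- `min(ρ/Λₙ, Λₙ/ρ) ≤ klRelGain n ρ` for `0 ≤ ρ` (the shell-count factor is `≥ 1`). -/
theorem klbd_min_le_klRelGain (n : ℕ) {ρ : ℝ} (hρ : 0 ≤ ρ) :
    min (ρ / klScale klE0 n) (klScale klE0 n / ρ) ≤ klRelGain n ρ := by
  have hΛ : 0 ≤ klScale klE0 n := by unfold klScale klE0; positivity
  have hmin : 0 ≤ min (ρ / klScale klE0 n) (klScale klE0 n / ρ) := le_min (div_nonneg hρ hΛ) (div_nonneg hΛ hρ)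
  have h1 : (1 : ℝ) ≤ 1 + (klShellCount n ρ : ℝ) := by
    have := Nat.cast_nonneg (α := ℝ) (klShellCount n ρ); linarith
  unfold klRelGain
  exact le_mul_of_one_le_right hmin h1

/-- **The `min` profile convolved against a WINDOWED weight** (window centre `x`, profile read at `|c − x|_𝕋`): `≤ (n+2)·(A·Λₙ·(1+2I) + Z/2^I)` for every `I`. -/
theorem klbd_minProfile_conv_le (w : TorusSite 2 L → ℝ) (n I : ℕ) {η₀ A Z : ℝ} (hw : ∀ c, 0 ≤ w c) (hη₀ : η₀ ≤ klScale klE0 n) (x : TorusSite 2 L)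
    (hmass : ∀ η : ℝ, η₀ ≤ η → ∑ c ∈ (univ : Finset (TorusSite 2 L)).filter (fun c => klTorusNorm L (c - x) ≤ η), w c ≤ A * η) (hZ : ∑ c, w c ≤ Z) :
    ∑ c, min (klTorusNorm L (c - x) / klScale klE0 n) (klScale klE0 n / klTorusNorm L (c - x)) * w c ≤
      (n + 2) * (A * klScale klE0 n * (1 + 2 * I) + Z / 2 ^ I) :=
  (Finset.sum_le_sum fun c _ => mul_le_mul_of_nonneg_right (klbd_min_le_klRelGain n (torusSupNorm_nonneg _)) (hw c)).trans
    (klam_sum_relGain_mul_le w n I hw hη₀ x hmass hZ)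

/-- The same with the profile read at `|x − c|_𝕋` (the row shape `Σ_c X(x,c)·w(c)` of the left dressing). -/
theorem klbd_minProfile_conv_le_left (w : TorusSite 2 L → ℝ) (n I : ℕ) {η₀ A Z : ℝ} (hw : ∀ c, 0 ≤ w c) (hη₀ : η₀ ≤ klScale klE0 n) (x : TorusSite 2 L)
    (hmass : ∀ η : ℝ, η₀ ≤ η → ∑ c ∈ (univ : Finset (TorusSite 2 L)).filter (fun c => klTorusNorm L (c - x) ≤ η), w c ≤ A * η) (hZ : ∑ c, w c ≤ Z) :
    ∑ c, min (klTorusNorm L (x - c) / klScale klE0 n) (klScale klE0 n / klTorusNorm L (x - c)) * w c ≤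
      (n + 2) * (A * klScale klE0 n * (1 + 2 * I) + Z / 2 ^ I) := by
  simp_rw [klvr_klTorusNorm_sub_comm x]
  exact klbd_minProfile_conv_le w n I hw hη₀ x hmass hZ

/-- The CROSSED profile read at `|x + c − Qm|_𝕋`: the window is centred at `Qm − x`. -/
theorem klbd_minProfile_conv_le_crossed (w : TorusSite 2 L → ℝ) (n I : ℕ) {η₀ A Z : ℝ} (hw : ∀ c, 0 ≤ w c) (hη₀ : η₀ ≤ klScale klE0 n) (Qm x : TorusSite 2 L)
    (hmass : ∀ η : ℝ, η₀ ≤ η → ∑ c ∈ (univ : Finset (TorusSite 2 L)).filter (fun c => klTorusNorm L (c - (Qm - x)) ≤ η), w c ≤ A * η) (hZ : ∑ c, w c ≤ Z) :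
    ∑ c, min (klTorusNorm L (x + c - Qm) / klScale klE0 n) (klScale klE0 n / klTorusNorm L (x + c - Qm)) * w c ≤
      (n + 2) * (A * klScale klE0 n * (1 + 2 * I) + Z / 2 ^ I) := by
  have e : ∀ c : TorusSite 2 L, x + c - Qm = c - (Qm - x) := fun c => by abel
  simp_rw [e]
  exact klbd_minProfile_conv_le w n I hw hη₀ (Qm - x) hmass hZ

end Profile

/-! ## §3 Instances on the dressing's rung profiles -/

section Instances

variable {L M : ℕ} [NeZero L] (β μ : ℝ) (K : TrigPolyC4v) {R : RenConsts} {U : ℝ} {N : ℕ}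

/-- **The `min` profile at scale `n+1` against the rung profile `ρ_j′ = klRungProfile … n s_{n+1,j′}`** (left shape; window `A = 2·369144/π` at every centre, floor
`π/L ≤ Λₙ₊₁`, total `738288`): `Σ_c min(|x−c|/Λₙ₊₁, Λₙ₊₁/|x−c|)·ρ_j′(c) ≤ (n+3)·((2·369144/π)·Λₙ₊₁·(1+2I) + 738288/2^I)`. -/
theorem klbd_minProfile_conv_rungProfile_le (hK : FrameOK R U N μ K) (hβ : klBetaMin ≤ β) (hβL : β ≤ L) {n j' : ℕ} (hj' : n + 1 ≤ j')
    (hη₀ : Real.pi / (L : ℝ) ≤ klScale klE0 (n + 1)) (I : ℕ) (Qm x : TorusSite 2 L) :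
    ∑ c, min (klTorusNorm L (x - c) / klScale klE0 (n + 1)) (klScale klE0 (n + 1) / klTorusNorm L (x - c)) *
        klRungProfile L M β μ K n (softSymbolCompl L M β μ K (n + 1) j') Qm c ≤
      ((n + 1 : ℕ) + 2) * (2 * 369144 / Real.pi * klScale klE0 (n + 1) * (1 + 2 * I) + 738288 / 2 ^ I) :=
  klbd_minProfile_conv_le_left _ (n + 1) I (fun c => klRungProfile_nonneg β μ K (pos_of_klBetaMin_le hβ) n _ Qm c) hη₀ x
    (fun _ hη => sum_window_klRungProfile_compl_le_linear β μ K hK hβ hβL hj' Qm x hη) (sum_klRungProfile_compl_le β μ K hK hβ hβL hj' Qm)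

/-- The right shape `Σ_a ρ_j(a)·min(|a−y|/Λₙ₊₁, Λₙ₊₁/|a−y|)` (same numbers). -/
theorem klbd_rungProfile_conv_minProfile_le (hK : FrameOK R U N μ K) (hβ : klBetaMin ≤ β) (hβL : β ≤ L) {n j : ℕ} (hj : n + 1 ≤ j)
    (hη₀ : Real.pi / (L : ℝ) ≤ klScale klE0 (n + 1)) (I : ℕ) (Qm y : TorusSite 2 L) :
    ∑ a, klRungProfile L M β μ K n (softSymbolCompl L M β μ K (n + 1) j) Qm a *
        min (klTorusNorm L (a - y) / klScale klE0 (n + 1)) (klScale klE0 (n + 1) / klTorusNorm L (a - y)) ≤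
      ((n + 1 : ℕ) + 2) * (2 * 369144 / Real.pi * klScale klE0 (n + 1) * (1 + 2 * I) + 738288 / 2 ^ I) := by
  simp_rw [mul_comm (klRungProfile L M β μ K n _ Qm _)]
  exact klbd_minProfile_conv_le _ (n + 1) I (fun c => klRungProfile_nonneg β μ K (pos_of_klBetaMin_le hβ) n _ Qm c) hη₀ y
    (fun _ hη => sum_window_klRungProfile_compl_le_linear β μ K hK hβ hβL hj Qm y hη) (sum_klRungProfile_compl_le β μ K hK hβ hβL hj Qm)

/-- The crossed left shape `Σ_c min(|x+c−Qm′|/Λₙ₊₁, Λₙ₊₁/|x+c−Qm′|)·ρ_j′(c)` (window centred at `Qm′ − x`; same numbers). -/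
theorem klbd_minProfile_conv_rungProfile_le_crossed (hK : FrameOK R U N μ K) (hβ : klBetaMin ≤ β) (hβL : β ≤ L) {n j' : ℕ} (hj' : n + 1 ≤ j')
    (hη₀ : Real.pi / (L : ℝ) ≤ klScale klE0 (n + 1)) (I : ℕ) (Qm Qm' x : TorusSite 2 L) :
    ∑ c, min (klTorusNorm L (x + c - Qm') / klScale klE0 (n + 1)) (klScale klE0 (n + 1) / klTorusNorm L (x + c - Qm')) *
        klRungProfile L M β μ K n (softSymbolCompl L M β μ K (n + 1) j') Qm c ≤
      ((n + 1 : ℕ) + 2) * (2 * 369144 / Real.pi * klScale klE0 (n + 1) * (1 + 2 * I) + 738288 / 2 ^ I) :=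
  klbd_minProfile_conv_le_crossed _ (n + 1) I (fun c => klRungProfile_nonneg β μ K (pos_of_klBetaMin_le hβ) n _ Qm c) hη₀ Qm' x
    (fun _ hη => sum_window_klRungProfile_compl_le_linear β μ K hK hβ hβL hj' Qm (Qm' - x) hη) (sum_klRungProfile_compl_le β μ K hK hβ hβL hj' Qm)

/-- The crossed right shape `Σ_a ρ_j(a)·min(|a+y−Qm′|/Λₙ₊₁, Λₙ₊₁/|a+y−Qm′|)` (same numbers). -/
theorem klbd_rungProfile_conv_minProfile_le_crossed (hK : FrameOK R U N μ K) (hβ : klBetaMin ≤ β) (hβL : β ≤ L) {n j : ℕ} (hj : n + 1 ≤ j)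
    (hη₀ : Real.pi / (L : ℝ) ≤ klScale klE0 (n + 1)) (I : ℕ) (Qm Qm' y : TorusSite 2 L) :
    ∑ a, klRungProfile L M β μ K n (softSymbolCompl L M β μ K (n + 1) j) Qm a *
        min (klTorusNorm L (a + y - Qm') / klScale klE0 (n + 1)) (klScale klE0 (n + 1) / klTorusNorm L (a + y - Qm')) ≤
      ((n + 1 : ℕ) + 2) * (2 * 369144 / Real.pi * klScale klE0 (n + 1) * (1 + 2 * I) + 738288 / 2 ^ I) := by
  simp_rw [mul_comm (klRungProfile L M β μ K n _ Qm _)]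
  have e : ∀ a : TorusSite 2 L, a + y - Qm' = y + a - Qm' := fun a => by abel
  simp_rw [e]
  exact klbd_minProfile_conv_le_crossed _ (n + 1) I (fun c => klRungProfile_nonneg β μ K (pos_of_klBetaMin_le hβ) n _ Qm c) hη₀ Qm' y
    (fun _ hη => sum_window_klRungProfile_compl_le_linear β μ K hK hβ hβL hj Qm (Qm' - y) hη) (sum_klRungProfile_compl_le β μ K hK hβ hβL hj Qm)

end Instances

end Summit.HubbardSuperconductivity.HubbardSuperconductivity.Theorems.KLRegimeSplit

end
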